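import Summits.BirchSwinnertonDyer.BirchSwinnertonDyer.Theorems.QuadraticBranchSignedControlPlusKatoDivisibilityEtaTwist
import Summits.BirchSwinnertonDyer.BirchSwinnertonDyer.Theorems.QuadraticBranchSignedControlPlusKatoDivisibilityBranchOntoOfFacts
import Literature.NumberTheory.EllipticCurves.Kobayashi2003.EtaColemanPoitouTateZetaSequencesContragredient
import Literature.NumberTheory.EllipticCurves.Kato2004.EulerSystemBoundFineSelmerContragredient
import HarnessLib

/-!
# K8, Kato side PRINT-EXACT at `η`: Kobayashi Thm. 2.2/4.1 from the CONTRAGREDIENT η-zeta package (`hZ′`, p608027) and the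
# contragredient Kato 13.4 (`Q73′`, p600084) — same-prime chain; and its `ι`-form on the tree's η-data

Cell `bsd-potss` (HOME `run/shared/lean/pub/bsd-potss/`), seat `bsd-potss-k8q-c2x` g10 (prover; lane B of the K8 Kato side,
route `QuadraticBranchSignedControl`), duty T-Q73ι-2 «K8-IOTA» (planner g27, kit `plan/rekey-20445-g27/`, work order S2).
HONEST FRAMING: THEOREMS ONLY — no definition, no named fact, no instance, no `sorry`; closes no item by itself; every
public theorem displays its named-fact inputs as hypotheses — `hZc` = `Kobayashi2003.thm62_63_73_etaColemanPoitouTate_zeta_contra`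
(Kobayashi Thm. 6.2/6.3/7.3 i)/Cor. 7.2 at `η`, `z` a genuine Euler-system class, duals CONTRAGREDIENT — print-exact, p608027),
`h134c` = `Kato2004.thm13_4_lengthAt_fineSelmerDualContra_le_of_isEulerSystemClass` (Kato Thm. 13.4 on the contragredient fine
dual — print-exact, p600084); Kato's and Kobayashi's theorems are NOT proved here; BSD is not proved by any of this.

## What and why

The bsd-cited audit (RELAY 46/51, rulings (647)/(660)) found BOTH Kato-side inputs of crux 20445 as typed — `hZ` (duals `D`, `FB`
over `γ` against the covariant `𝐇¹`) and Q73 (tree fine dual over `γ`) — to be PRINT ∘ ι, and their print-exact twins `hZ′` / Q73′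
(duals over `γ⁻¹`) were landed. Seat k8q-c2x g9 certified (p607149) that the LITERAL crux from the print-exact inputs costs an
unprinted `ι`-symmetry; the planner's ruling T-Q73ι-2 re-keys K8 to what print DOES give on the tree's duals, (RK⁺)^ι
`Additive.QuadraticBranchPlusKatoDivisibilityIotaAt` (`Char X⁺(V/ℚ_∞)·(ι Lη) ⊆ Char X⁺(V/F_∞)`, with an FE-free consumer there).
THIS FILE is the `η`-level producer, in the kernel:

* §1 private copies (contragredient currency) of g2/g4's kernel steps (`KatoSideOnto`): `(pⁿ)·char ⊆ char` from local lengths,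
  the four-term char-ideal factor, `Col⁺ z ≠ 0` (Rohrlich), `𝐇¹/Λz` torsion, and Kato 13.4 (2)/(3) on the pinned class for
  `FB : W.FineSelmerDualData κ γ⁻¹` AT THE SAME PRIME — Q73′ verbatim, no `ι`, no symmetry.
* §2 **`etaKatoDivisibilityContra_of_zetaContra_of_thm13_4Contra`** — Kobayashi Thm. 2.2 (`+`) and Thm. 4.1 at `η` for ONE curve
  and EVERY contragredient datum `D : …EtaSignedSelmerDualData V κ K₀ ℚ_[p] ηq γ⁻¹ 1` from `{hZ′, Q73′}` under (v) for `V^{(p*)}`: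
  f.g., torsion, `pⁿ Lη ∈ Char`, `Lη ∈ Char` on onto rows — PRINT-EXACT, ι-free (planner sketch S2b `EtaKatoDivisibilityContra`).
* §3 **`etaKatoDivisibilityInvol_of_zetaContra_of_thm13_4Contra`** — the same read on the TREE-convention datum `D` over `γ`:
  `pⁿ·ι Lη ∈ Char`, `ι Lη ∈ Char` on onto rows (§2 at the η-twin of `…EtaTwist` + `ι² = id`). No functional equation, no
  symmetry hypothesis. The (RK⁺)^ι row and the by-name branch producer are the sequel `…PlusKatoDivisibilityIotaOfNamedFactsContra`.

References: [Kobayashi2003] Def. 2.1, Thm. 2.2, 4.1, 5.2, 6.2, 6.3, Prop. 7.1, Cor. 7.2, Thm. 7.3 (7.21), proof of Thm. 7.4, last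
sentence of §7 (pp. 2–13); [Kato2004Asterisque] §12.2, (12.5.2) (p. 222), Thm. 13.4 (p. 226), §17.13; [Greenberg1989] pp. 101–102
(`S^ι`); [Washington1997] §13.2.
-/

noncomputable section

-- justification: the `Summit.BirchSwinnertonDyer.BirchSwinnertonDyer.…` path repeats a component (route-file convention)
set_option linter.dupNamespace false
set_option autoImplicit false

open scoped Classical

namespace Summit.BirchSwinnertonDyer.BirchSwinnertonDyer.Theorems

namespace KatoSideIotaContra

/-! ## §1 Private kernel steps in the CONTRAGREDIENT currency (fine dual over `γ⁻¹`, same prime) -/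

open CongruenceSubgroup Field WeierstrassCurve
open Literature.NumberTheory.EllipticCurves
open Literature.NumberTheory.EllipticCurves.ModularForms
open Literature.NumberTheory.EllipticCurves.Module
open Literature.NumberTheory.GaloisRepresentations
open Summit.BirchSwinnertonDyer.Rank1Residual.Additive hiding EtaSignedSelmerDualData
open Summit.BirchSwinnertonDyer.Rank1Residual.Additive.SignedTwist
open Summit.BirchSwinnertonDyer.BirchSwinnertonDyer.Theses.QuadraticBranchSignedControl
open SignedKatoOffTwo.IwasawaInvolution

section Algebra

variable {p : ℕ} [Fact p.Prime]
  {M : Type} [AddCommGroup M] [_root_.Module (IwasawaAlgebra p) M] [Module.Finite (IwasawaAlgebra p) M]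
  {N : Type} [AddCommGroup N] [_root_.Module (IwasawaAlgebra p) N] [Module.Finite (IwasawaAlgebra p) N]

/-- `ℓ_𝔭(N) ≤ ℓ_𝔭(M)` at the height-one primes `𝔭 ∌ p` ⟹ `(pⁿ)·char(M) ⊆ char(N)` for some `n` (g2's lemma,
private copy as in `KatoSideOnto`). [cite: Washington1997, §13.2] -/
private theorem exists_span_pow_mul_charIdeal_le_of_lengthAt_le (hM : Module.IsTorsion (IwasawaAlgebra p) M)
    (hN : Module.IsTorsion (IwasawaAlgebra p) N)
    (h : ∀ 𝔭 : PrimeSpectrum (IwasawaAlgebra p), 𝔭.asIdeal.height = 1 →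
      PowerSeries.C (p : ℤ_[p]) ∉ 𝔭.asIdeal →
        lengthAt (IwasawaAlgebra p) N 𝔭 ≤ lengthAt (IwasawaAlgebra p) M 𝔭) :
    ∃ n : ℕ, Ideal.span {(p : IwasawaAlgebra p) ^ n} * charIdeal (IwasawaAlgebra p) M ≤
      charIdeal (IwasawaAlgebra p) N := by
  obtain ⟨t, π, ht, -, -, hchar⟩ := SkinnerUrban2014.exists_charIdeal_eq_span_prod (M := M) hM
  set g : IwasawaAlgebra p := ∏ 𝔮 ∈ t, π 𝔮 ^ (lengthAt (IwasawaAlgebra p) M 𝔮).toNat with hg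
  have hg0 : g ≠ 0 :=
    Finset.prod_ne_zero_iff.mpr fun 𝔮 h𝔮 ↦ pow_ne_zero _ (ht 𝔮 h𝔮).2.1.ne_zero
  have hby : Module.IsTorsionBy (IwasawaAlgebra p) (IwasawaAlgebra p ⧸ Ideal.span {g}) g :=
    (Module.isTorsionBy_quotient_iff _ g).mpr fun y ↦ by
      rw [smul_eq_mul]
      exact Ideal.mul_mem_right y _ (Ideal.mem_span_singleton_self g)
  have hQ : Module.IsTorsion (IwasawaAlgebra p) (IwasawaAlgebra p ⧸ Ideal.span {g}) :=
    fun x ↦ ⟨⟨g, mem_nonZeroDivisors_of_ne_zero hg0⟩, @hby x⟩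
  have hcharQ : charIdeal (IwasawaAlgebra p) (IwasawaAlgebra p ⧸ Ideal.span {g}) =
      charIdeal (IwasawaAlgebra p) M := by
    rw [charIdeal_eq_span_of_lengthAt_eq_quotient hg0 fun _ _ ↦ rfl, hchar]
  have hlen : ∀ 𝔭 : PrimeSpectrum (IwasawaAlgebra p), 𝔭.asIdeal.height = 1 →
      PowerSeries.C (p : ℤ_[p]) ∉ 𝔭.asIdeal →
      lengthAt (IwasawaAlgebra p) N 𝔭 ≤
        lengthAt (IwasawaAlgebra p) (IwasawaAlgebra p ⧸ Ideal.span {g}) 𝔭 := fun 𝔭 h𝔭 hp𝔭 ↦ by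
    rw [SkinnerUrban2014.lengthAt_eq_of_charIdeal_eq hQ hM hcharQ 𝔭 h𝔭]
    exact h 𝔭 h𝔭 hp𝔭
  obtain ⟨m, hm⟩ :=
    exists_pow_mul_mem_charIdeal_of_lengthAt_le hN (IwasawaAlgebra.prime_C p) hg0 hlen
  refine ⟨m, ?_⟩
  rw [hchar, Ideal.span_singleton_mul_span_singleton, Ideal.span_singleton_le_iff_mem]
  have hp' : ((p : ℕ) : IwasawaAlgebra p) = PowerSeries.C (p : ℤ_[p]) := by rw [map_natCast]
  rw [hp']
  exact hm

variable {R : Type} [CommRing R] [IsNoetherianRing R] [IsDomain R] [UniqueFactorizationMonoid R]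
variable {A X B : Type} [AddCommGroup A] [_root_.Module R A] [AddCommGroup X] [_root_.Module R X]
  [AddCommGroup B] [_root_.Module R B]

/-- `J·char(A) ⊆ char(B) ⟹ J·(L) ⊆ char(X)` along an exact `0 → A → R/(L) → X → B → 0` (g0's lemma, private copy).
[cite: Kobayashi2003, proof of Thm. 7.4 and last sentence of §7 (p. 13)] -/
private theorem mul_span_singleton_le_charIdeal_of_fourTermExact [Module.Finite R B]
    (hB : Module.IsTorsion R B) {L : R} (hL : L ≠ 0)
    (f : A →ₗ[R] R ⧸ Ideal.span {L}) (g : (R ⧸ Ideal.span {L}) →ₗ[R] X) (h : X →ₗ[R] B)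
    (hf : Function.Injective f) (hfg : Function.Exact f g) (hgh : Function.Exact g h)
    (hh : Function.Surjective h) (J : Ideal R)
    (hAB : J * Module.charIdeal R A ≤ Module.charIdeal R B) :
    J * Ideal.span {L} ≤ Module.charIdeal R X := by
  obtain ⟨q, e1, e2⟩ :=
    Thm74Skeleton.exists_charIdeal_factor_of_fourTermExact hB hL f g h hf hfg hgh hh
  calc J * Ideal.span {L} = J * Module.charIdeal R A * q := by rw [e1, mul_assoc]
    _ ≤ Module.charIdeal R B * q := Ideal.mul_mono_left hAB
    _ = Module.charIdeal R X := by rw [e2, mul_comm]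

end Algebra

section Row

variable {p : ℕ} [Fact p.Prime] {K₀ : Type} [Field K₀] [NumberField K₀]
  [(galRange (K := ℚ) K₀).Normal] {η : absoluteGaloisGroup ℚ →* ℤˣ}
  {V : WeierstrassCurve ℚ} [V.IsElliptic] [V.IsGloballyMinimal] {N : ℕ} [NeZero N]
  {f : CuspForm (Gamma0 N) 2} {ϖ : ℚ} {κ : ZpExtension ℚ p} {γ : absoluteGaloisGroup ℚ}
  {W : WeierstrassCurve ℚ} [W.IsElliptic] [ContinuousSMul ℤ_[p] (W.tateModule p)]
  [Module.Free ℤ_[p] (W.tateModule p)] [Module.Finite ℤ_[p] (W.tateModule p)]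
  {I : Kato2004.IwasawaH1Data W p κ γ} {FB : W.FineSelmerDualData κ γ⁻¹}

/-- `Col⁺(z) ≠ 0` on a genuine contragredient frame: `Col⁺(z) = L_p⁺(V, η, X) ≠ 0` (Rohrlich; periods positive).
[cite: Kobayashi2003, Thm. 6.3 (p. 11) and Thm. 7.3 i) (p. 13)] -/
private theorem colPlus_z_ne_zero
    (E : Kobayashi2003.EtaColemanPoitouTateZetaDataContra p K₀ η V f ϖ κ γ W I FB)
    (hp2 : p ≠ 2) (hgood : V.HasGoodReductionAtPrime p) (hf : IsNewformOf V f)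
    (hϖ : if Even (p / 2) then (ϖ : ℝ) * V.realPeriodRat = plusPeriod f
      else (ϖ : ℝ) * V.imaginaryPeriodRat = minusPeriod f) : E.colPlus E.z ≠ 0 := by
  have hϖ0 : ϖ ≠ 0 := by
    rintro rfl
    rw [Rat.cast_zero, zero_mul, zero_mul] at hϖ
    by_cases h2 : Even (p / 2)
    · rw [if_pos h2] at hϖ
      exact (IsNewform0.plusPeriod_pos_holds hf.1 hf.coeffField_eq_bot).ne hϖ
    · rw [if_neg h2] at hϖ
      exact (IsNewform0.minusPeriod_pos_holds hf.1 hf.coeffField_eq_bot).ne hϖ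
  exact IsQuadraticBranchPlusLFunction.ne_zero_of_isNewformOf hp2 hf hgood hϖ0 E.isPlus_colPlus_z

/-- `z ≠ 0` and `𝐇¹_Γ(T_pW)/Λz` is torsion on a genuine contragredient frame (killed by `Col⁺(z) ≠ 0`, `Col⁺ ∘ loc`
injective). [cite: Kobayashi2003, Thm. 7.3 i) (p. 13)] -/
private theorem z_ne_zero_and_isTorsion_quotient
    (E : Kobayashi2003.EtaColemanPoitouTateZetaDataContra p K₀ η V f ϖ κ γ W I FB)
    (hp2 : p ≠ 2) (hgood : V.HasGoodReductionAtPrime p) (hf : IsNewformOf V f)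
    (hϖ : if Even (p / 2) then (ϖ : ℝ) * V.realPeriodRat = plusPeriod f
      else (ϖ : ℝ) * V.imaginaryPeriodRat = minusPeriod f) :
    E.z ≠ 0 ∧ Module.IsTorsion (IwasawaAlgebra p) (I.H ⧸ Submodule.span (IwasawaAlgebra p) {E.z}) := by
  have hL0 := colPlus_z_ne_zero E hp2 hgood hf hϖ
  refine ⟨fun hz => hL0 (by rw [hz, map_zero]), ?_⟩
  intro x
  refine ⟨⟨E.colPlus E.z, mem_nonZeroDivisors_of_ne_zero hL0⟩, ?_⟩
  induction x using Submodule.Quotient.induction_on with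
  | H m =>
    rw [Submonoid.mk_smul, ← Submodule.Quotient.mk_smul, Submodule.Quotient.mk_eq_zero,
      Submodule.mem_span_singleton]
    refine ⟨E.colPlus m, E.colPlus_injective ?_⟩
    rw [map_smul, map_smul, smul_eq_mul, smul_eq_mul, mul_comm]

/-- **Kato 13.4 (2)/(3) on the pinned class, CONTRAGREDIENT fine dual, SAME prime** (`(pⁿ)·Char(𝐇¹_Γ/Λz) ⊆ Char X₀` under
(v) for `W`; integrally when `ρ̄_{V,p^m}` is onto for all `m`, via (12.5.2) for the twist) — Q73′ applied VERBATIM to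
`FB : W.FineSelmerDualData κ γ⁻¹`; no `ι`, no symmetry. [cite: Kato2004Asterisque, Thm. 13.4 (2)(3) (p. 226), (12.5.2) (p. 222)] -/
private theorem kato_bounds_of_zetaContra
    (E : Kobayashi2003.EtaColemanPoitouTateZetaDataContra p K₀ η V f ϖ κ γ W I FB)
    (h134c : Kato2004.thm13_4_lengthAt_fineSelmerDualContra_le_of_isEulerSystemClass)
    (hFB : Module.Finite (IwasawaAlgebra p) FB.X)
    (hp2 : p ≠ 2) (hgood : V.HasGoodReductionAtPrime p) (hf : IsNewformOf V f)
    (hϖ : if Even (p / 2) then (ϖ : ℝ) * V.realPeriodRat = plusPeriod f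
      else (ϖ : ℝ) * V.imaginaryPeriodRat = minusPeriod f)
    (hκ : κ.IsCyclotomic) (hγ : κ.IsTopGenerator γ) (C : VariableChange ℚ)
    (hWV : C • W.quadraticTwist (((-1 : ℚ) ^ (p / 2)) * p) = V)
    (hv : ∃ σ : absoluteGaloisGroup ℚ,
      (∀ (n : ℕ) (t : AlgebraicClosure ℚ), t ^ p ^ n = 1 → σ • t = t) ∧
        Module.finrank ℤ_[p]
          ((W.tateModule p) ⧸ LinearMap.range (W.galoisRepTate p σ - 1)) = 1) :
    (∃ n : ℕ, Ideal.span {(p : IwasawaAlgebra p) ^ n} *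
        Module.charIdeal (IwasawaAlgebra p) (I.H ⧸ Submodule.span (IwasawaAlgebra p) {E.z}) ≤
      Module.charIdeal (IwasawaAlgebra p) FB.X) ∧
    ((∀ m : ℕ, V.HasSurjectiveModNGaloisRep (p ^ m : ℕ)) →
      Module.charIdeal (IwasawaAlgebra p) (I.H ⧸ Submodule.span (IwasawaAlgebra p) {E.z}) ≤
        Module.charIdeal (IwasawaAlgebra p) FB.X) := by
  have hp : p.Prime := Fact.out
  haveI : Module.Finite (IwasawaAlgebra p) I.H :=
    Kato2004.IwasawaH1Data.module_finite_of_isCyclotomic hκ hγ I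
  haveI : Module.Finite (IwasawaAlgebra p) FB.X := hFB
  obtain ⟨hz0, htor⟩ := z_ne_zero_and_isTorsion_quotient E hp2 hgood hf hϖ
  refine ⟨?_, fun hsurj => ?_⟩
  · obtain ⟨h2, -⟩ := h134c W p κ γ hp2 hκ hγ I FB E.z E.isEulerSystemClass_z hz0 hv
    exact exists_span_pow_mul_charIdeal_le_of_lengthAt_le htor E.isTorsion_fine h2
  · haveI : NeZero ((p : ℕ) : ℚ) := ⟨Nat.cast_ne_zero.mpr hp.ne_zero⟩
    have hirrV : V.HasIrreducibleModPGaloisRep p :=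
      hasIrreducibleModPGaloisRep_of_hasSurjectiveModNGaloisRep V p (by simpa using hsurj 1)
    have hc : (((-1 : ℚ) ^ (p / 2)) * p) ≠ 0 :=
      mul_ne_zero (pow_ne_zero _ (by norm_num)) (Nat.cast_ne_zero.mpr hp.ne_zero)
    have hirrW : W.HasIrreducibleModPGaloisRep p := by
      have h1 := Mazur1978.hasIrreducibleModPGaloisRep_smul_iff
        (W.quadraticTwist (((-1 : ℚ) ^ (p / 2)) * p)) C p
      rw [hWV] at h1
      exact (W.hasIrreducibleModPGaloisRep_quadraticTwist_iff hc p).mp (h1.mp hirrV)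
    have h3W :=
      Kato2004.exists_coker_free_of_smul_eq_quadraticTwist_primeStar_of_forall_hasSurjectiveModNGaloisRep
        hp2 C hWV hsurj
    have hvW :=
      Kato2004.exists_finrank_coker_eq_one_of_smul_eq_quadraticTwist_primeStar_of_forall_hasSurjectiveModNGaloisRep
        hp2 C hWV hsurj
    obtain ⟨-, h3⟩ := h134c W p κ γ hp2 hκ hγ I FB E.z E.isEulerSystemClass_z hz0 hvW
    exact Kim2025.charIdeal_le_charIdeal_of_lengthAt_le htor E.isTorsion_fine (h3 hirrW h3W)

end Row

/-! ## §2 Kobayashi Thm. 2.2 (`+`) / Thm. 4.1 at `η` for a CONTRAGREDIENT η-datum — print-exact, ι-free -/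

section Eta

variable {p : ℕ} [Fact p.Prime]

/-- **Kobayashi Thm. 2.2 (`+`) and Thm. 4.1 at the quadratic `η` for ONE curve and EVERY CONTRAGREDIENT dual datum
`D : EtaSignedSelmerDualData V κ K₀ ℚ_[p] ηq γ⁻¹ 1` of `Sel⁺(V/K_∞)^η`, from the PRINT-EXACT pair `{hZ′, Q73′}`** under the ROW
hypothesis (v) for `V^{(p*)}` (his printed proof, last sentence of §7, run in the contragredient world where (7.21) is
`Λ`-linear and Q73′ bounds `X₀` by `𝐇¹/Λz` AT THE SAME PRIME): `X(D)` is finitely generated `Λ`-torsion,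
`pⁿ·L_p⁺(V,η,X) ∈ Char X(D)` for some `n`, and `L_p⁺(V,η,X) ∈ Char X(D)` if `ρ̄_{V,p^m}` is onto for all `m` — for ANY `Lη` with
the interpolation property (`IsQuadraticBranchPlusLFunction.span_singleton_eq`). The fine datum over `γ⁻¹` is produced from a
`γ`-datum by bsd-wall's `exists_twist_fineSelmerDualData_invol` (its finite generation by §1). No functional equation, no
`ι`-symmetry. This is the planner's sketch S2b `EtaKatoDivisibilityContra`, binder for binder.
[cite: Kobayashi2003, Thm. 2.2 (p. 5), Thm. 4.1 (p. 8), Thm. 7.3 i) (7.21) and the proof of Thm. 7.4 (p. 13)]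
[cite: Kato2004Asterisque, Thm. 13.4 (2)(3) (p. 226), (12.5.2) (p. 222)] -/
theorem etaKatoDivisibilityContra_of_zetaContra_of_thm13_4Contra
    (hZc : Kobayashi2003.thm62_63_73_etaColemanPoitouTate_zeta_contra)
    (h134c : Kato2004.thm13_4_lengthAt_fineSelmerDualContra_le_of_isEulerSystemClass)
    (K₀ : Type) [Field K₀] [NumberField K₀] [IsCyclotomicExtension {p} ℚ K₀]
    [(galRange (K := ℚ) K₀).Normal] (ηq : absoluteGaloisGroup ℚ →* ℤˣ)
    (hηK : ∀ σ ∈ galRange (K := ℚ) K₀, ηq σ = 1) (hη1 : ηq ≠ 1)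
    (V : WeierstrassCurve ℚ) [V.IsElliptic] [V.IsGloballyMinimal]
    (hv : ∀ [(V.quadraticTwist (((-1 : ℚ) ^ (p / 2)) * p)).IsElliptic],
      ∃ σ : absoluteGaloisGroup ℚ,
        (∀ (n : ℕ) (t : AlgebraicClosure ℚ), t ^ p ^ n = 1 → σ • t = t) ∧
          Module.finrank ℤ_[p]
            (((V.quadraticTwist (((-1 : ℚ) ^ (p / 2)) * p)).tateModule p) ⧸
              LinearMap.range
                ((V.quadraticTwist (((-1 : ℚ) ^ (p / 2)) * p)).galoisRepTate p σ - 1)) = 1)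
    {N : ℕ} [NeZero N] {f : CuspForm (Gamma0 N) 2} (hp2 : p ≠ 2)
    (hgood : V.HasGoodReductionAtPrime p) (hap : V.frobeniusTrace p = 0) (hf : IsNewformOf V f)
    (ϖ : ℚ) (hϖ : if Even (p / 2) then (ϖ : ℝ) * V.realPeriodRat = plusPeriod f
      else (ϖ : ℝ) * V.imaginaryPeriodRat = minusPeriod f)
    (Lη : IwasawaAlgebra p)
    (hL : Summit.BirchSwinnertonDyer.Rank1Residual.Additive.IsQuadraticBranchPlusLFunction f p ϖ Lη)
    (κ : ZpExtension ℚ p) (γ : absoluteGaloisGroup ℚ) (hκ : κ.IsCyclotomic) (hγ : κ.IsTopGenerator γ)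
    (hγK : γ ∈ galRange (K := ℚ) K₀) (hγc : IsCyclotomicVariable p γ)
    (D : Kobayashi2003.EtaSignedSelmerDualData V κ K₀ ℚ_[p] ηq γ⁻¹ 1) :
    Module.Finite (IwasawaAlgebra p) D.X ∧ Module.IsTorsion (IwasawaAlgebra p) D.X ∧
      (∃ n : ℕ, (p : IwasawaAlgebra p) ^ n * Lη ∈ D.charIdeal) ∧
      ((∀ m : ℕ, V.HasSurjectiveModNGaloisRep (p ^ m : ℕ)) → Lη ∈ D.charIdeal) := by
  have hc : (((-1 : ℚ) ^ (p / 2)) * p) ≠ 0 :=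
    mul_ne_zero (pow_ne_zero _ (by norm_num)) (Nat.cast_ne_zero.mpr (Fact.out : p.Prime).ne_zero)
  haveI : (V.quadraticTwist (((-1 : ℚ) ^ (p / 2)) * p)).IsElliptic := V.isElliptic_quadraticTwist hc
  haveI : ContinuousSMul ℤ_[p] ((V.quadraticTwist (((-1 : ℚ) ^ (p / 2)) * p)).tateModule p) :=
    TateModule.continuousSMul_padicInt
  haveI : Module.Free ℤ_[p] ((V.quadraticTwist (((-1 : ℚ) ^ (p / 2)) * p)).tateModule p) :=
    (V.quadraticTwist (((-1 : ℚ) ^ (p / 2)) * p)).module_free_tateModule_holds p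
  haveI : Module.Finite ℤ_[p] ((V.quadraticTwist (((-1 : ℚ) ^ (p / 2)) * p)).tateModule p) :=
    (V.quadraticTwist (((-1 : ℚ) ^ (p / 2)) * p)).module_finite_tateModule_holds p
  obtain ⟨C, hC⟩ := exists_variableChange_twist_twist V hc
  obtain ⟨I⟩ := Kato2004.nonempty_iwasawaH1Data_holds (V.quadraticTwist (((-1 : ℚ) ^ (p / 2)) * p))
    p κ γ hκ hγ
  -- a fine dual datum over `γ`, twisted to `γ⁻¹` (finite generation transported)
  obtain ⟨FB₀⟩ := (V.quadraticTwist (((-1 : ℚ) ^ (p / 2)) * p)).nonempty_fineSelmerDualData κ hγ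
  haveI : Module.Finite (IwasawaAlgebra p) FB₀.X :=
    WeierstrassCurve.FineSelmerDualData.module_finite _ κ hγ FB₀
  obtain ⟨FB, eFB, heFB, -, -, -, -⟩ := exists_twist_fineSelmerDualData_invol (p := p) (mul_inv_cancel γ) FB₀
  have hFB : Module.Finite (IwasawaAlgebra p) FB.X :=
    moduleFinite_of_semilinear_equiv
      (IwasawaAlgebra.involEquiv p : IwasawaAlgebra p ≃+* IwasawaAlgebra p) eFB (fun g x ↦ heFB g x)
  obtain ⟨E⟩ := hZc p K₀ ηq hηK hη1 V hp2 hgood hap hf ϖ hϖ κ γ hκ hγ hγK hγc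
    (V.quadraticTwist (((-1 : ℚ) ^ (p / 2)) * p)) C hC I FB
  obtain ⟨⟨n, hn⟩, hint⟩ := kato_bounds_of_zetaContra E h134c hFB hp2 hgood hf hϖ hκ hγ C hC hv
  obtain ⟨j, k, hcj, hjk, hk⟩ := E.exact_plus D
  obtain ⟨i, j', k', hi, hij, hjk', hk'⟩ :=
    Thm74Skeleton.exists_fourTermExact_of_threeTermExact E.colPlus j k E.colPlus_injective hcj hjk hk
      E.z
  have hL0 : E.colPlus E.z ≠ 0 := colPlus_z_ne_zero E hp2 hgood hf hϖ
  have hspan : Ideal.span ({Lη} : Set (IwasawaAlgebra p)) = Ideal.span {E.colPlus E.z} :=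
    IsQuadraticBranchPlusLFunction.span_singleton_eq hp2 hL E.isPlus_colPlus_z
  haveI : Module.Finite (IwasawaAlgebra p) FB.X := hFB
  refine ⟨Module.Finite.of_exact hjk hk,
    Thm74Skeleton.isTorsion_of_exact (Thm74Skeleton.isTorsion_quotient_span_singleton hL0)
      E.isTorsion_fine j' k' hjk', ⟨n, ?_⟩, fun hsurj => ?_⟩
  · have hle := mul_span_singleton_le_charIdeal_of_fourTermExact E.isTorsion_fine hL0
      i j' k' hi hij hjk' hk' _ hn
    rw [← hspan, Ideal.span_singleton_mul_span_singleton, Ideal.span_singleton_le_iff_mem] at hle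
    exact hle
  · have hle := Thm74Skeleton.span_singleton_le_charIdeal_of_fourTermExact E.isTorsion_fine hL0
      i j' k' hi hij hjk' hk' (hint hsurj)
    rw [← hspan, Ideal.span_singleton_le_iff_mem] at hle
    exact hle

/-! ## §3 The same for the TREE-convention η-datum (over `γ`): the divisor is `ι L_p⁺(V, η, X)` -/

/-- **Kobayashi Thm. 2.2 (`+`) / Thm. 4.1 at `η` READ ON THE TREE's η-datum `D` over `γ` (`T` by pre-composition = print's
dual twisted by `ι`) from the print-exact `{hZ′, Q73′}`: `X(D)` is finitely generated `Λ`-torsion, `pⁿ · ι Lη ∈ Char X(D)` for some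
`n`, and `ι Lη ∈ Char X(D)` on tower-onto rows** — §4 applied to the §2-twin `D′` of `D` over `γ⁻¹` (`Char X(D′) = ι Char X(D)`),
then `ι² = id`. EXACTLY what print gives on the tree's duals; no functional equation, no symmetry hypothesis.
[cite: Kobayashi2003, Thm. 2.2 (p. 5), Thm. 4.1 (p. 8), Def. 2.1 (p. 5)] [cite: Kato2004Asterisque, Thm. 13.4 (p. 226)]
[cite: Greenberg1989, pp. 101–102 (S^ι)] -/
theorem etaKatoDivisibilityInvol_of_zetaContra_of_thm13_4Contra
    (hZc : Kobayashi2003.thm62_63_73_etaColemanPoitouTate_zeta_contra)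
    (h134c : Kato2004.thm13_4_lengthAt_fineSelmerDualContra_le_of_isEulerSystemClass)
    (K₀ : Type) [Field K₀] [NumberField K₀] [IsCyclotomicExtension {p} ℚ K₀]
    [(galRange (K := ℚ) K₀).Normal] (ηq : absoluteGaloisGroup ℚ →* ℤˣ)
    (hηK : ∀ σ ∈ galRange (K := ℚ) K₀, ηq σ = 1) (hη1 : ηq ≠ 1)
    (V : WeierstrassCurve ℚ) [V.IsElliptic] [V.IsGloballyMinimal]
    (hv : ∀ [(V.quadraticTwist (((-1 : ℚ) ^ (p / 2)) * p)).IsElliptic],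
      ∃ σ : absoluteGaloisGroup ℚ,
        (∀ (n : ℕ) (t : AlgebraicClosure ℚ), t ^ p ^ n = 1 → σ • t = t) ∧
          Module.finrank ℤ_[p]
            (((V.quadraticTwist (((-1 : ℚ) ^ (p / 2)) * p)).tateModule p) ⧸
              LinearMap.range
                ((V.quadraticTwist (((-1 : ℚ) ^ (p / 2)) * p)).galoisRepTate p σ - 1)) = 1)
    {N : ℕ} [NeZero N] {f : CuspForm (Gamma0 N) 2} (hp2 : p ≠ 2)
    (hgood : V.HasGoodReductionAtPrime p) (hap : V.frobeniusTrace p = 0) (hf : IsNewformOf V f)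
    (ϖ : ℚ) (hϖ : if Even (p / 2) then (ϖ : ℝ) * V.realPeriodRat = plusPeriod f
      else (ϖ : ℝ) * V.imaginaryPeriodRat = minusPeriod f)
    (Lη : IwasawaAlgebra p)
    (hL : Summit.BirchSwinnertonDyer.Rank1Residual.Additive.IsQuadraticBranchPlusLFunction f p ϖ Lη)
    (κ : ZpExtension ℚ p) (γ : absoluteGaloisGroup ℚ) (hκ : κ.IsCyclotomic) (hγ : κ.IsTopGenerator γ)
    (hγK : γ ∈ galRange (K := ℚ) K₀) (hγc : IsCyclotomicVariable p γ)
    (D : Kobayashi2003.EtaSignedSelmerDualData V κ K₀ ℚ_[p] ηq γ 1) :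
    Module.Finite (IwasawaAlgebra p) D.X ∧ Module.IsTorsion (IwasawaAlgebra p) D.X ∧
      (∃ n : ℕ, (p : IwasawaAlgebra p) ^ n * IwasawaAlgebra.invol p Lη ∈ D.charIdeal) ∧
      ((∀ m : ℕ, V.HasSurjectiveModNGaloisRep (p ^ m : ℕ)) → IwasawaAlgebra.invol p Lη ∈ D.charIdeal) := by
  -- twist `D` (over `γ`) to `D′` over `γ⁻¹`
  obtain ⟨D', e, -, -, htors, hfin, hchar, -⟩ := exists_twist_etaSignedSelmerDualData_invol (mul_inv_cancel γ) D
  obtain ⟨hfin', htor', ⟨n, hn⟩, hint⟩ :=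
    etaKatoDivisibilityContra_of_zetaContra_of_thm13_4Contra hZc h134c K₀ ηq hηK hη1 V hv hp2 hgood hap hf
      ϖ hϖ Lη hL κ γ hκ hγ hγK hγc D'
  -- `Char X(D) = ι Char X(D′)` since `Char X(D′) = ι Char X(D)` and `ι² = id`
  have hback : D.charIdeal = D'.charIdeal.map (IwasawaAlgebra.invol p) := by
    rw [hchar, ideal_map_invol_map_invol p]
  have hmem : ∀ x : IwasawaAlgebra p, x ∈ D'.charIdeal → IwasawaAlgebra.invol p x ∈ D.charIdeal :=
    fun x hx ↦ by rw [hback]; exact Ideal.mem_map_of_mem _ hx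
  refine ⟨hfin.mpr hfin', htors.mpr htor', ⟨n, ?_⟩, fun hsurj ↦ hmem _ (hint hsurj)⟩
  have h1 := hmem _ hn
  rwa [map_mul, map_pow, map_natCast] at h1

end Eta

end KatoSideIotaContra

end Summit.BirchSwinnertonDyer.BirchSwinnertonDyer.Theorems

end
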